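import Summits.CriticalPhenomena.Ising3DConformalLimit.Theses.HyperoctahedralRP
import Summits.CriticalPhenomena.Ising3DConformalLimit.Theorems.MoebiusLimitExists.Negative.TwoPointPositivity
import Summits.CriticalPhenomena.Ising3DConformalLimit.Theorems.MoebiusLimitExists.Negative.FreeTranslations
import Summits.CriticalPhenomena.Ising3DConformalLimit.Theorems.MoebiusLimitExists.Negative.ScaleRedundant
import Summits.CriticalPhenomena.Ising3DConformalLimit.Theorems.MoebiusLimitExists.Negative.ScaleFree
import Summits.CriticalPhenomena.Ising3DConformalLimit.Theorems.MoebiusLimitExists.Negative.OnlyInteractionTightness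
import Summits.CriticalPhenomena.Ising3DConformalLimit.Theorems.MoebiusLimitExists.Negative.LocalBoundsDoubling
import Literature.Probability.LatticeModels.PointwiseScalingLimitEtaExists
import Mathlib.Analysis.SpecialFunctions.Log.Base
import HarnessLib

/-!
# `ExistsScaleCovariantLimit` (item stmt-CriticalPhenomena-1981): the dyadic re-pinning identity and
crux ⟹ dyadic convergence to a scale-covariant limit (part 1 of the dyadic form)

Negative / structural knowledge about the crux
`Summit.CriticalPhenomena.Ising3DConformalLimit.Theses.HyperoctahedralRP.ExistsScaleCovariantLimit`,
standing crux disprover, cycle 2 (D-0016); THEOREM-ONLY (pinned zoom = `rescaledCorrelator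
(criticalCorr 3) rhoPin`, dyadic meshes `(2^k)⁻¹`, axis pairs `![0, single 0 s]`).

* `pz_scale`: the exact re-pinning identity `pz n (δ/s) x = pz₂(δ)(0, s e₀)^{-n/2} · pz n δ (s·x)`;
  `pz_two_cfg0_le_one`, `pz_two_cfg0_anti` (Messager–Miracle-Solé along the axis);
* `hasPointwiseScalingLimit_rhoPin`, `dyadic_of_crux`: crux ⟹ the pinned zoom converges along `2^{-k}`
  (all `n`, locally uniformly off the diagonals) to a limit scale covariant on `NonCoincident`;
* `dyadic_decomposition`: `δ = s⁻¹2^{-k}`, `s ∈ [1,2)`, `k → ∞` — the bookkeeping of part 2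
  (`Negative/DyadicForm.lean`: the converse and `crux_iff_dyadic`).

[folklore]
-/

noncomputable section

namespace Summit.CriticalPhenomena.Ising3DConformalLimit.ExistsScaleCovariantLimitNegative.Dyadic

open Literature.Probability.LatticeModels Filter Set
open scoped Topology
open Summit.CriticalPhenomena.Ising3DConformalLimit.Theses
open Summit.CriticalPhenomena.Ising3DConformalLimit.MoebiusLimitExistsNegative
open Summit.CriticalPhenomena.Ising3DConformalLimit.MoebiusLimitExistsOnlyInteraction (rhoPin)
open Summit.CriticalPhenomena.Ising3DConformalLimit.PinnedClusterPoints
open Summit.CriticalPhenomena.Ising3DConformalLimit.OnlyInteractionTightness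
  (limit_isBoundedUnder tendstoLocallyUniformlyOn_comp_tendsto abs_rescaledCorrelator_le)


/-- `dyad_pos` (bookkeeping). [folklore] -/
theorem dyad_pos (k : ℕ) : 0 < ((2:ℝ) ^ k)⁻¹ := by positivity

/-- `dyad_le_one` (bookkeeping). [folklore] -/
theorem dyad_le_one (k : ℕ) : ((2:ℝ) ^ k)⁻¹ ≤ 1 :=
  inv_le_one_of_one_le₀ (one_le_pow₀ one_le_two)

/-- `dyad_mem` (bookkeeping). [folklore] -/
theorem dyad_mem (k : ℕ) : ((2:ℝ) ^ k)⁻¹ ∈ Set.Ioc (0:ℝ) 1 := ⟨dyad_pos k, dyad_le_one k⟩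

/-- `tendsto_dyad` (bookkeeping). [folklore] -/
theorem tendsto_dyad : Tendsto (fun k : ℕ => ((2:ℝ) ^ k)⁻¹) atTop (𝓝[>] (0:ℝ)) := by
  refine tendsto_nhdsWithin_iff.2 ⟨?_, Filter.Eventually.of_forall dyad_pos⟩
  exact tendsto_inv_atTop_zero.comp (tendsto_pow_atTop_atTop_of_one_lt one_lt_two)

/-! ### The pinned zoom at axis pairs -/

/-- `pz_two_cfg0` (elementary bookkeeping). [folklore] -/
theorem pz_two_cfg0 (δ s : ℝ) :
    rescaledCorrelator (criticalCorr 3) rhoPin 2 δ (![0, EuclideanSpace.single 0 s] : Fin 2 → EuclideanSpace ℝ (Fin 3)) = criticalTwoPoint 3 (Pi.single 0 ⌊s / δ⌋) / criticalTwoPoint 3 (Pi.single 0 ⌊1 / δ⌋) :=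
  rescaled_pin_cfg0s δ s

/-- `pz_two_cfg0_pos` (bookkeeping). [folklore] -/
theorem pz_two_cfg0_pos (δ s : ℝ) : 0 < rescaledCorrelator (criticalCorr 3) rhoPin 2 δ (![0, EuclideanSpace.single 0 s] : Fin 2 → EuclideanSpace ℝ (Fin 3)) := by
  rw [pz_two_cfg0]
  exact div_pos (criticalTwoPoint_pos3 _) (criticalTwoPoint_pos3 _)

/-- Axis monotonicity (Messager–Miracle-Solé): `G(⌊a⌋e₀) ≤ G(⌊b⌋e₀)` for `0 ≤ b ≤ a`. [folklore] -/
theorem criticalTwoPoint_floor_antitone {a b : ℝ} (hb : 0 ≤ b) (hab : b ≤ a) :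
    criticalTwoPoint 3 (Pi.single 0 ⌊a⌋) ≤ criticalTwoPoint 3 (Pi.single 0 ⌊b⌋) := by
  have ha0 : 0 ≤ ⌊a⌋ := Int.floor_nonneg.2 (hb.trans hab)
  have hb0 : 0 ≤ ⌊b⌋ := Int.floor_nonneg.2 hb
  have h := criticalTwoPoint_axis_antitone (Int.toNat_le_toNat (Int.floor_le_floor hab))
  simp only at h
  rwa [Int.toNat_of_nonneg ha0, Int.toNat_of_nonneg hb0] at h

/-- For `s ≥ 1` (and `δ > 0`) the pinned pair ratio is `≤ 1`. [folklore] -/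
theorem pz_two_cfg0_le_one {δ s : ℝ} (hδ : 0 < δ) (hs : 1 ≤ s) : rescaledCorrelator (criticalCorr 3) rhoPin 2 δ (![0, EuclideanSpace.single 0 s] : Fin 2 → EuclideanSpace ℝ (Fin 3)) ≤ 1 := by
  rw [pz_two_cfg0, div_le_one (criticalTwoPoint_pos3 _)]
  exact criticalTwoPoint_floor_antitone (by positivity) (div_le_div_of_nonneg_right hs hδ.le)

/-- The pinned pair ratio is non-increasing in `s ≥ 0`. [folklore] -/
theorem pz_two_cfg0_anti {δ s s' : ℝ} (hδ : 0 < δ) (hs : 0 ≤ s) (hss' : s ≤ s') :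
    rescaledCorrelator (criticalCorr 3) rhoPin 2 δ (![0, EuclideanSpace.single 0 s'] : Fin 2 → EuclideanSpace ℝ (Fin 3)) ≤ rescaledCorrelator (criticalCorr 3) rhoPin 2 δ (![0, EuclideanSpace.single 0 s] : Fin 2 → EuclideanSpace ℝ (Fin 3)) := by
  rw [pz_two_cfg0, pz_two_cfg0]
  exact div_le_div_of_nonneg_right
    (criticalTwoPoint_floor_antitone (by positivity) (div_le_div_of_nonneg_right hss' hδ.le))
    (criticalTwoPoint_pos3 _).le

/-! ### The exact scale identity of the pinned zoom -/

/-- `ρ_pin(δ/s)ⁿ = (pz₂(δ)(0, s e₀))^{-n/2} ρ_pin(δ)ⁿ` for `s, δ > 0`. [folklore] -/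
theorem rhoPin_pow_scale {s δ : ℝ} (hs : 0 < s) (hδ : 0 < δ) (n : ℕ) :
    rhoPin (s⁻¹ * δ) ^ n = (rescaledCorrelator (criticalCorr 3) rhoPin 2 δ (![0, EuclideanSpace.single 0 s] : Fin 2 → EuclideanSpace ℝ (Fin 3))) ^ (-(n:ℝ) / 2) * rhoPin δ ^ n := by
  rw [pz_two_cfg0]
  have e : (1:ℝ) / (s⁻¹ * δ) = s / δ := by field_simp
  unfold rhoPin
  rw [e]
  set A := criticalTwoPoint 3 (Pi.single 0 ⌊s / δ⌋) with hA
  set B := criticalTwoPoint 3 (Pi.single 0 ⌊1 / δ⌋) with hB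
  have hA0 : 0 < A := criticalTwoPoint_pos3 _
  have hB0 : 0 < B := criticalTwoPoint_pos3 _
  rw [← Real.rpow_natCast (A ^ (-(1/2:ℝ))) n, ← Real.rpow_mul hA0.le,
    ← Real.rpow_natCast (B ^ (-(1/2:ℝ))) n, ← Real.rpow_mul hB0.le,
    Real.div_rpow hA0.le hB0.le]
  have h1 : (-(1/2:ℝ)) * n = -(n:ℝ) / 2 := by ring
  rw [h1, div_eq_mul_inv (A ^ (-(n:ℝ)/2)), ← Real.rpow_neg hB0.le, neg_div, neg_neg, mul_assoc,
    ← Real.rpow_add hB0]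
  have h2 : (n:ℝ) / 2 + -((n:ℝ) / 2) = 0 := by ring
  rw [show -(↑n / 2) = -((n:ℝ)/2) by ring] -- normalise
  rw [h2, Real.rpow_zero, mul_one]

/-- **Exact scale identity**: `rescaledCorrelator (criticalCorr 3) rhoPin n (δ/s) x = (rescaledCorrelator (criticalCorr 3) rhoPin 2 δ (0, s e₀))^{-n/2} · rescaledCorrelator (criticalCorr 3) rhoPin n δ (s·x)` — the zoom
at the finer mesh `δ/s` is the zoom at mesh `δ` of the dilated configuration, re-pinned. [folklore] -/
theorem pz_scale {s δ : ℝ} (hs : 0 < s) (hδ : 0 < δ) (n : ℕ) (x : Fin n → EuclideanSpace ℝ (Fin 3)) :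
    rescaledCorrelator (criticalCorr 3) rhoPin n (s⁻¹ * δ) x = (rescaledCorrelator (criticalCorr 3) rhoPin 2 δ (![0, EuclideanSpace.single 0 s] : Fin 2 → EuclideanSpace ℝ (Fin 3))) ^ (-(n:ℝ) / 2) * rescaledCorrelator (criticalCorr 3) rhoPin n δ (fun i => s • x i) := by
  rw [rescaledCorrelator_apply, rescaledCorrelator_apply, rhoPin_pow_scale hs hδ n, mul_assoc]
  congr 2
  congr 1
  funext i
  have h := latticeApprox_smul_smul (inv_pos.2 hs) δ (s • x i)
  rw [smul_smul, inv_mul_cancel₀ hs.ne', one_smul] at h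
  exact h

/-! ### Configurations: dilated reference pair, compact images -/

/-- `smul_cfg01` (elementary bookkeeping). [folklore] -/
theorem smul_cfg01 (s : ℝ) : (fun i => s • (![0, EuclideanSpace.single 0 1] : Fin 2 → EuclideanSpace ℝ (Fin 3)) i) = (![0, EuclideanSpace.single 0 s] : Fin 2 → EuclideanSpace ℝ (Fin 3)) := by
  funext i
  fin_cases i
  · simp
  · simp only [Matrix.cons_val_one, Matrix.cons_val_fin_one, Fin.mk_one]
    ext j
    by_cases hj : j = 0
    · subst hj; simp
    · simp [hj]

/-- `cfg0_mem` (bookkeeping). [folklore] -/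
theorem cfg0_mem {s : ℝ} (hs : s ≠ 0) : (![0, EuclideanSpace.single 0 s] : Fin 2 → EuclideanSpace ℝ (Fin 3)) ∈ NonCoincident 3 2 :=
  zero_unitVec_mem_nonCoincident hs

/-- The value of a scale-covariant dyadic limit on the axis: `S₂(0, s e₀) = s^{-2Δ}` (given
`S₂(0,e₀) = 1`). [folklore] -/
theorem two_cfg0_eq {S : CorrFamily 3} {Δ : ℝ} (h1 : S 2 (![0, EuclideanSpace.single 0 1] : Fin 2 → EuclideanSpace ℝ (Fin 3)) = 1)
    (hsc : ∀ (n : ℕ) (c : ℝ), 0 < c → ∀ x ∈ NonCoincident 3 n,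
      S n (fun i => c • x i) = c ^ (-(n:ℝ) * Δ) * S n x) {s : ℝ} (hs : 0 < s) :
    S 2 (![0, EuclideanSpace.single 0 s] : Fin 2 → EuclideanSpace ℝ (Fin 3)) = s ^ (-(2:ℝ) * Δ) := by
  have h := hsc 2 s hs _ (cfg0_mem one_ne_zero)
  rw [smul_cfg01, h1, mul_one] at h
  exact_mod_cast h

/-! ### crux ⟹ dyadic convergence to a scale-covariant limit -/

/-- The pinned zoom converges along the full filter under a witness (cf. `PinnedForm`). [folklore] -/
theorem hasPointwiseScalingLimit_rhoPin {ρ : ℝ → ℝ} {S' : CorrFamily 3}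
    (hρ : ∀ δ ∈ Set.Ioc (0:ℝ) 1, 0 < ρ δ)
    (hlim : HasPointwiseScalingLimit (criticalCorr 3) ρ S') (hnd : IsNondegenerateTwoPoint S') :
    HasPointwiseScalingLimit (criticalCorr 3) rhoPin
      (fun n x => ((S' 2 (![0, EuclideanSpace.single 0 1] : Fin 2 → EuclideanSpace ℝ (Fin 3))) ^ (-(1 / 2 : ℝ))) ^ n * S' n x) := by
  intro n
  have hA : 0 < S' 2 (![0, EuclideanSpace.single 0 1] : Fin 2 → EuclideanSpace ℝ (Fin 3)) := hnd _ cfg01_mem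
  set r : ℝ → ℝ := fun δ => (rescaledCorrelator (criticalCorr 3) ρ 2 δ (![0, EuclideanSpace.single 0 1] : Fin 2 → EuclideanSpace ℝ (Fin 3))) ^ (-(1 / 2 : ℝ)) with hr
  have hr_t : Tendsto (fun δ => r δ ^ n) (𝓝[>] (0:ℝ)) (𝓝 (((S' 2 (![0, EuclideanSpace.single 0 1] : Fin 2 → EuclideanSpace ℝ (Fin 3))) ^ (-(1 / 2 : ℝ))) ^ n)) :=
    ((((hlim 2).tendsto_at cfg01_mem).rpow_const (p := -(1 / 2 : ℝ)) (Or.inl hA.ne')).pow n)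
  have hF1 : TendstoLocallyUniformlyOn (fun δ (_ : Fin n → EuclideanSpace ℝ (Fin 3)) => r δ ^ n)
      (fun _ => ((S' 2 (![0, EuclideanSpace.single 0 1] : Fin 2 → EuclideanSpace ℝ (Fin 3))) ^ (-(1 / 2 : ℝ))) ^ n) (𝓝[>] (0:ℝ)) (NonCoincident 3 n) :=
    (hr_t.tendstoUniformlyOn_const (NonCoincident 3 n)).tendstoLocallyUniformlyOn
  have hprod := hF1.mul₀_of_isBoundedUnder (hlim n)
    (fun x _ => isBoundedUnder_of ⟨dist (((S' 2 (![0, EuclideanSpace.single 0 1] : Fin 2 → EuclideanSpace ℝ (Fin 3))) ^ (-(1 / 2 : ℝ))) ^ n) 0, fun _ => le_rfl⟩)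
    (fun x hx => limit_isBoundedUnder hlim n hx)
  refine hprod.congr_inseparable ?_
  filter_upwards [Ioc_mem_nhdsGT one_pos] with δ hδ x _
  exact Inseparable.of_eq (rescaled_pin_eq (hρ δ hδ) n x).symm

/-- `rhoPin_pos` (bookkeeping). [folklore] -/
theorem rhoPin_pos (δ : ℝ) : 0 < rhoPin δ := Real.rpow_pos_of_pos (criticalTwoPoint_pos3 _) _

/-- **crux ⟹ the dyadic pinned zoom converges (all `n`, locally uniformly off the diagonals) to a
limit which is scale covariant on non-coincident configurations.** [folklore] -/
theorem dyadic_of_crux (h : HyperoctahedralRP.ExistsScaleCovariantLimit) :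
    ∃ S : CorrFamily 3, (∀ n, TendstoLocallyUniformlyOn (fun k => rescaledCorrelator (criticalCorr 3) rhoPin n (((2:ℝ) ^ k)⁻¹)) (S n) atTop
      (NonCoincident 3 n)) ∧ ∃ Δ : ℝ, ∀ (n : ℕ) (c : ℝ), 0 < c → ∀ x ∈ NonCoincident 3 n,
        S n (fun i => c • x i) = c ^ (-(n:ℝ) * Δ) * S n x := by
  obtain ⟨ρ, Δ₀, S', hρ, -, hlim', -, hnd', -, -⟩ := h
  have hlim := hasPointwiseScalingLimit_rhoPin hρ hlim' hnd'
  set S : CorrFamily 3 := fun n x => ((S' 2 (![0, EuclideanSpace.single 0 1] : Fin 2 → EuclideanSpace ℝ (Fin 3))) ^ (-(1 / 2 : ℝ))) ^ n * S' n x with hS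
  have hρ' : ∀ δ ∈ Set.Ioc (0:ℝ) 1, 0 < rhoPin δ := fun δ _ => rhoPin_pos δ
  have h1 : S 2 (![0, EuclideanSpace.single 0 1] : Fin 2 → EuclideanSpace ℝ (Fin 3)) = 1 := by
    have h := (hlim 2).tendsto_at cfg01_mem
    have h' : Tendsto (fun δ : ℝ => (1:ℝ)) (𝓝[>] (0:ℝ)) (𝓝 (S 2 (![0, EuclideanSpace.single 0 1] : Fin 2 → EuclideanSpace ℝ (Fin 3)))) :=
      h.congr fun δ => rescaled_pin_cfg01 δ
    exact (tendsto_nhds_unique tendsto_const_nhds h').symm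
  have hnd : IsNondegenerateTwoPoint S :=
    (isNondegenerateTwoPoint_iff_exists_pos hlim).2 ⟨_, cfg01_mem, by rw [h1]; exact one_pos⟩
  obtain ⟨Δ, -, hcov⟩ := hlim.exists_rpow_scale (by norm_num) hρ' hnd
  exact ⟨S, fun n => tendstoLocallyUniformlyOn_comp_tendsto (hlim n) tendsto_dyad, Δ, hcov⟩

/-! ### The converse: dyadic convergence + scale covariance ⟹ full-filter convergence -/

/-- Dyadic decomposition of a mesh: `δ = s⁻¹ 2^{-k}` with `s ∈ [1,2)` and `k = ⌊log₂ δ⁻¹⌋`; if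
`δ < 2^{-K₀}` then `k ≥ K₀`. [folklore] -/
theorem dyadic_decomposition {δ : ℝ} (hδ : 0 < δ) (hδ1 : δ < 1) (K₀ : ℕ) (hK : δ < ((2:ℝ) ^ K₀)⁻¹) :
    ∃ (k : ℕ) (s : ℝ), K₀ ≤ k ∧ 1 ≤ s ∧ s < 2 ∧ δ = s⁻¹ * ((2:ℝ) ^ k)⁻¹ := by
  set L : ℝ := Real.logb 2 δ⁻¹ with hL
  have hδi : 1 < δ⁻¹ := one_lt_inv₀ hδ |>.2 hδ1
  have hL0 : 0 ≤ L := (Real.logb_pos one_lt_two hδi).le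
  set k : ℕ := ⌊L⌋₊ with hk
  have hk1 : (k:ℝ) ≤ L := Nat.floor_le hL0
  have hk2 : L < (k:ℝ) + 1 := Nat.lt_floor_add_one L
  -- `2^k ≤ δ⁻¹ < 2^(k+1)`
  have hlo : (2:ℝ) ^ k ≤ δ⁻¹ := by
    have := (Real.le_logb_iff_rpow_le one_lt_two (inv_pos.2 hδ)).1 hk1
    rwa [Real.rpow_natCast] at this
  have hhi : δ⁻¹ < (2:ℝ) ^ (k + 1) := by
    have hk2' : L < ((k + 1 : ℕ) : ℝ) := by push_cast; exact hk2
    have := (Real.logb_lt_iff_lt_rpow one_lt_two (inv_pos.2 hδ)).1 hk2'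
    rwa [Real.rpow_natCast] at this
  refine ⟨k, δ⁻¹ * ((2:ℝ) ^ k)⁻¹, ?_, ?_, ?_, ?_⟩
  · -- `K₀ ≤ k` from `δ < 2^{-K₀}`
    have hK' : (K₀:ℝ) ≤ L := by
      have h2 : (2:ℝ) ^ K₀ < δ⁻¹ := by
        rw [lt_inv_comm₀ (by positivity) hδ]
        exact hK
      have := (Real.lt_logb_iff_rpow_lt one_lt_two (inv_pos.2 hδ)).2 (by rwa [Real.rpow_natCast])
      exact this.le
    exact Nat.le_floor hK'
  · rw [le_mul_inv_iff₀ (by positivity), one_mul]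
    exact hlo
  · rw [mul_inv_lt_iff₀ (by positivity), pow_succ] at *
    linarith [hhi]
  · have hd : ((2:ℝ) ^ k)⁻¹ ≠ 0 := (dyad_pos k).ne'
    field_simp

end Summit.CriticalPhenomena.Ising3DConformalLimit.ExistsScaleCovariantLimitNegative.Dyadic

end
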